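import Summits.SmoothPoincare4.SmoothPoincare4.Theses.DissolvableGluck

/-!
# DissolvableGluck — the split glue `DissolvableIsGluck → GluckTwistsStandard → CP2CancellationOne`

Proves the support item `SplitGlue` (stmt-SmoothPoincare4-17712, support, rank 9) of
route-SmoothPoincare4-DissolvableGluck:
`DissolvableIsGluck → GluckTwistsStandard → CP2CancellationOne`
(stmt-SmoothPoincare4-17709 → 17711 → 17708, the route's target).

Pure logic (per homotopy 4-sphere `M` with `M # CP² ≅ CP²`: `DissolvableIsGluck` exhibits `M` as a Gluck twist of
some 2-knot `K`, `GluckTwistsStandard` concludes `M ≅ S⁴`) — the route's `closes` with the dissolution as a hypothesis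
instead of `DissolveOne`. Root decomposition cell decomp-sp4 (D-0178), LANDING LIST 2 (writer g6); 0 sorry.
Nothing here proves `SmoothPoincare4`.
-/

set_option linter.dupNamespace false

namespace Summit.SmoothPoincare4.SmoothPoincare4.Theorems.DissolvableGluckSplitGlue

open Summit.SmoothPoincare4.SmoothPoincare4.Theses.DissolvableGluck

/-- Item stmt-SmoothPoincare4-17712: «CP²-dissolvable ⇒ Gluck twist» + «Gluck twists are standard» give
one-fold `CP²`-cancellation. -/
theorem splitGlue_holds : SplitGlue := by
  intro h₂ h₃ M _ _ _ _ _ e hd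
  obtain ⟨K, hK⟩ := h₂ M e hd
  exact h₃ K M hK

end Summit.SmoothPoincare4.SmoothPoincare4.Theorems.DissolvableGluckSplitGlue
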